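import Summits.BirchSwinnertonDyer.BirchSwinnertonDyer.Theorems.PrintCf2SplitBadTwoNormAtVbarReduction
import Summits.BirchSwinnertonDyer.BirchSwinnertonDyer.Theorems.PrintCf2SplitBadTwoKummerUProNullAssembly
import Summits.BirchSwinnertonDyer.BirchSwinnertonDyer.Theorems.PrintCf2SplitBadTwoDoublyAdaptedPair
import Literature.NumberTheory.Automorphic.GaloisActionPlaces
import Literature.NumberTheory.GaloisRepresentations.ArtinReciprocityCharacterFiniteProofs
import Literature.NumberTheory.GaloisCohomology.CyclotomicKillingPrimePower
import Mathlib.NumberTheory.RamificationInertia.Galois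
import Mathlib.NumberTheory.RamificationInertia.Valuation
import HarnessLib

/-!
# Crux `PrintCf2.SplitBadTwoRankOneOfFacts` (stmt-BirchSwinnertonDyer-20368), skeleton v13.5, (REG₂) `stub_xRegular_two` FACT-FREE road, R2 brick
# **B5-U FILE 2: TOTAL RAMIFICATION AT `v̄` AND THE ASSEMBLED `hB5`** — `ord_v̄(N_{F/K} b) = ord_{w′}(b)` at the totally ramified place, so the
# `v̄`-clause of the dual-Shapiro class yields EXACTLY the `(v̄)` hypothesis «`p^M ∣ ord_{w′}(b)` at every `w′ ∣ v̄`» of the class-level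
# (PRO-NULL)_U, i.e. -w8 g5's displayed binder `hB5` of `LayerShapiro.exists_level_levelSurj_of_classProNull` (B3d, p706446)

Cell `bsd-print-cf2`, EXTRA WIDTH seat `bsd-line-cf2-p1-w3` g14 (prover-bsd-line-cf2-p1-w3-g14-0); `--supports stmt-BirchSwinnertonDyer-20368`
(helper, Theses-free). HONEST FRAMING: nothing here closes the crux or a registered stub; BSD is not proved by any of this; no summit
statement is proved by this seat. No definition, no named fact, no `sorry`. UNCONDITIONAL. Sequel of FILE 1 `…NormAtVbarReduction` (p706643):
there the `v̄`-clause gives `(n : ℤ) ∣ log v_v̄(N_{F/K} b)`; here: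
* §1 `log_valuation_eq_log_valuation_norm_of_forall_mem_inertia` — `F/K` finite Galois number fields, `w ∣ v` with inertia group ALL of `Gal(F/K)`:
  `log v_w(b) = log v_v(N_{F/K} b)` (Mathlib Hilbert theory: `Ideal.card_inertia_eq_ramificationIdxIn` ⟹ `e(w∣v) = [F:K]`; `valuation_liesOver`;
  `Algebra.norm_eq_prod_automorphisms` with every `σ` fixing `w`); `forall_mem_inertia_of_absolute` — the `Γ_K`-currency input
  «`Γ_K = I_𝔓 · Gal(K̄/F)`» gives that hypothesis for the place below `𝔓`; `log_valuation_eq_log_valuation_norm_of_totallyRamified` — at EVERY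
  `w′ : v̄.Extension (𝓞 F)` (going up to a prime `𝔓 ∣ w′` of `\bar ℤ_K`, -w3 g13 `KummerU.exists_prime_absIntegers_comap_eq`).
* §2 **`dvd_log_valuation_of_dualShapiro_mem_of_totallyRamified`** — THE ASSEMBLED B5-U in the exact shape of B3d's `hB5` binder (after the data
  `(ρ) (hM′) (B) (hB) (F) (hU) (hm₀) (hn0) (ι′) (hι′B) (vbar) (htot)`: `∀ {s} hs hs1 φ, ⟨6b clause (iii) at v̄⟩ → ∀ β, ⟨ι′ ∘ φ = ∂β on Gal(K̄/F)⟩ → ∀ b,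
  b = β^n → ∀ w′ : vbar.Extension (𝓞 F), (n : ℤ) ∣ log (w′.1.valuation F b)`); the one datum beyond B3d's context is that the coefficient embedding
  `ι′ : M′ ↪ K̄ˣ` be `B(m₀, ·)` for a `Γ_K`-fixed `m₀` (`hι′B`; for `ℤ/p^M ↔ μ_{p^M}`, `m₀ = 1`).
* §3 `forall_exists_inertia_mul_mem_galFixing_layer` — ON THE LINE the input `htot` HOLDS: for `K` imaginary quadratic, `p ∤ h_K`, `κ` THE
  `ℤ_p`-extension unramified outside `v̄`, every layer `K*_m` and every prime `𝔓 ∣ v̄`: `Γ_K = I_𝔓 · Gal(K̄/K*_m)` (-w2 g13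
  `DoublyAdaptedPair.exists_mem_inertia_apply_eq_of_isUnramifiedOutside` + `galFixing_layer`).
So for `θ = 1` (road (b)) the `v̄` input of the level assembly is DISCHARGED: `hB5 := dvd_log_valuation_of_dualShapiro_mem_of_totallyRamified
(ofSMul N hN) hN′ B hB (κ₂.layer m) hU hm₀ hn0 ι′ hι′B vbar (forall_exists_inertia_mul_mem_galFixing_layer hK hh hκ₂ m)`. NOT here: the twisted
`μ(ε)` case at the places of `F′ = F·K_ε` above `v̄` split over `F` (B3d′ / p705557's left disjunct), where `v̄` is NOT totally ramified in `F′`.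
presearch: «totally ramified valuation of norm», «inertia group equals Galois group ramification index» → Neukirch ANT I (9.6), II (9.x); Serre
*Local Fields* I §7; folklore, no new fact. beyond-print theorem: no.

References: [NeukirchANT1999] Ch. I §9 (9.4), (9.6), Ch. II §9; [SerreLocalFields1979] I §7 Prop. 22, VII §7, XIV §1 Prop. 3;
[NeukirchSchmidtWingberg2008] I §5 Prop. (1.5.3)(iv), I §6 (1.6.4); [deShalit1987] II.1.8, II.4.17; [Washington1997] §13.1 Prop. 13.2.
-/

noncomputable section

open scoped Classical Pointwise ContRepresentation

set_option linter.dupNamespace false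
set_option autoImplicit false

open CategoryTheory NumberField IsDedekindDomain Field IntermediateField
open Literature.NumberTheory.EllipticCurves Literature.NumberTheory.EllipticCurves.GreenbergSelmer
open Literature.NumberTheory.GaloisRepresentations Literature.NumberTheory.GaloisRepresentations.LocalWeilDatum
open Literature.NumberTheory.GaloisRepresentations.DiscreteGaloisModule (SelmerStructure mu MuCarrier TateDual tateDual
  coindTateDualMor coindTateDualHom unramifiedSubgroup localMap)
open Literature.NumberTheory.GaloisCohomology
open Summit.BirchSwinnertonDyer.Rank1Residual.X11b.LocBridge

namespace Summit.BirchSwinnertonDyer.BirchSwinnertonDyer.Theorems.PrintCf2.NormAtVbar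

/-! ## §1. Total ramification at a place of a Galois layer: `ord_w(b) = ord_v(N_{F/K} b)` -/

section TotallyRamified

variable {K : Type} [Field K] [NumberField K] (F : IntermediateField K (AlgebraicClosure K)) [FiniteDimensional K F] [IsGalois K F]
  [NumberField F]

/-- **Inertia = everything ⟹ `ord_w(b) = ord_v(N_{F/K} b)`.** For a finite Galois extension `F/K` of number fields and a place `w ∣ v` of `F`
whose inertia group in `Gal(F/K)` is ALL of `Gal(F/K)` (total ramification at `w`): `log v_w(b) = log v_v(N_{F/K} b)` for every `b ∈ F`.
(`e(w∣v) = #I(w∣v) = [F:K]` by `Ideal.card_inertia_eq_ramificationIdxIn`; `v_v(x)^e = v_w(x)` (`valuation_liesOver`); `N(b) = ∏_σ σb` with every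
`σ` fixing `w`, so `v_w(N b) = v_w(b)^{[F:K]}`; cancel the exponent.) [cite: NeukirchANT1999, Ch. I §9 (9.6), Ch. II §9] [cite: SerreLocalFields1979, I §7 Prop. 22] -/
theorem log_valuation_eq_log_valuation_norm_of_forall_mem_inertia (v : HeightOneSpectrum (𝓞 K)) (w : HeightOneSpectrum (𝓞 F))
    [w.asIdeal.LiesOver v.asIdeal] (hI : ∀ g : F ≃ₐ[K] F, g ∈ w.asIdeal.inertia (F ≃ₐ[K] F)) (b : F) :
    WithZero.log (w.valuation F b) = WithZero.log (v.valuation K (Algebra.norm K b)) := by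
  haveI : Module.Finite (𝓞 K) (𝓞 F) := IsIntegralClosure.finite (𝓞 K) K F (𝓞 F)
  haveI : IsGaloisGroup (F ≃ₐ[K] F) (𝓞 K) (𝓞 F) := IsGaloisGroup.of_isFractionRing (F ≃ₐ[K] F) (𝓞 K) (𝓞 F) K F
  haveI := v.isPrime
  haveI := w.isPrime
  -- `e(w ∣ v) = #I = #Gal(F/K)`
  have htop : w.asIdeal.inertia (F ≃ₐ[K] F) = ⊤ := eq_top_iff.2 fun g _ ↦ hI g
  have he : v.asIdeal.ramificationIdx' w.asIdeal = Nat.card (F ≃ₐ[K] F) := by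
    rw [Ideal.ramificationIdx'_eq_ramificationIdx v.asIdeal w.asIdeal v.ne_bot,
      ← Ideal.ramificationIdxIn_eq_ramificationIdx v.asIdeal w.asIdeal (F ≃ₐ[K] F),
      ← Ideal.card_inertia_eq_ramificationIdxIn (G := F ≃ₐ[K] F) v.asIdeal w.asIdeal, htop, Subgroup.card_top]
  -- `v(N b)^e = w(N b) = ∏_σ w(σ b) = w(b)^#G`
  have hval := HeightOneSpectrum.valuation_liesOver F v w (Algebra.norm K b)
  have hfix : ∀ σ : F ≃ₐ[K] F, σ • w = w := fun σ ↦ HeightOneSpectrum.ext (by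
    rw [Literature.NumberTheory.Automorphic.HeightOneSpectrum.smul_asIdeal]
    exact MulAction.mem_stabilizer_iff.mp (Ideal.inertia_le_stabilizer _ (hI σ)))
  have hσ : ∀ σ : F ≃ₐ[K] F, w.valuation F (σ b) = w.valuation F b := fun σ ↦ by
    have h := Literature.NumberTheory.Automorphic.HeightOneSpectrum.valuation_algEquiv_smul K σ w b
    rwa [hfix] at h
  rw [he, Algebra.norm_eq_prod_automorphisms K b, map_prod, Finset.prod_congr rfl fun σ _ ↦ hσ σ, Finset.prod_const,
    Finset.card_univ, ← Nat.card_eq_fintype_card] at hval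
  have hlog := congrArg WithZero.log hval
  rw [WithZero.log_pow, WithZero.log_pow, nsmul_eq_mul, nsmul_eq_mul] at hlog
  have hG : ((Nat.card (F ≃ₐ[K] F) : ℕ) : ℤ) ≠ 0 := by exact_mod_cast Nat.card_pos.ne'
  exact (mul_left_cancel₀ hG hlog).symm

omit [FiniteDimensional K F] [NumberField K] [NumberField F] in
/-- **`Γ_K = I_𝔓 · Gal(K̄/F)` ⟹ the inertia group of the place `w` of `F` below `𝔓` in `Gal(F/K)` is everything.** If every `σ ∈ Γ_K` is
`τ · u` with `τ` in the (absolute) inertia group `I_𝔓 ≤ Γ_K` of a prime `𝔓` of `\\bar ℤ_K` lying over `w` (`𝔓 ∩ 𝓞 F = 𝔭_w`) and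
`u ∈ Gal(K̄/F)`, then every `g ∈ Gal(F/K)` lies in the inertia group of `𝔭_w` (restriction `Γ_K ↠ Gal(F/K)` kills `Gal(K̄/F)` and intertwines the
actions on `𝓞 F ⊆ \\bar ℤ_K`, `ringOfIntegersToIntegralClosure_absRestrictNormalHom_smul`). [cite: NeukirchANT1999, Ch. I §9 (9.4)] -/
theorem forall_mem_inertia_of_absolute (w : HeightOneSpectrum (𝓞 F)) (𝔓 : Ideal (absIntegers (𝓞 K) K))
    (h𝔓 : 𝔓.comap (ringOfIntegersToIntegralClosure (k := K) (Ω := AlgebraicClosure K) F) = w.asIdeal)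
    (htot : ∀ σ : absoluteGaloisGroup K, ∃ τ ∈ 𝔓.inertia (absoluteGaloisGroup K), τ⁻¹ * σ ∈ galFixing K F) :
    ∀ g : F ≃ₐ[K] F, g ∈ w.asIdeal.inertia (F ≃ₐ[K] F) := by
  intro g
  obtain ⟨σ, hσ⟩ := AlgEquiv.restrictNormalHom_surjective (AlgebraicClosure K) g
  let σ' : absoluteGaloisGroup K := σ
  obtain ⟨τ, hτ, hτσ⟩ := htot σ'
  have hker : absRestrictNormalHom F (τ⁻¹ * σ') = 1 :=
    (MonoidHom.mem_ker (f := AlgEquiv.restrictNormalHom F)).mp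
      ((SetLike.ext_iff.mp (IntermediateField.restrictNormalHom_ker F) (τ⁻¹ * σ')).mpr hτσ)
  have hg : g = absRestrictNormalHom F τ := by
    rw [map_mul, map_inv, inv_mul_eq_one] at hker
    rw [hker]
    exact hσ.symm
  rw [hg, Ideal.inertia, AddSubgroup.mem_inertia]
  rw [Ideal.inertia, AddSubgroup.mem_inertia] at hτ
  intro y
  have h1 := hτ (ringOfIntegersToIntegralClosure (k := K) (Ω := AlgebraicClosure K) F y)
  rw [Submodule.mem_toAddSubgroup] at h1 ⊢
  have e1 : ringOfIntegersToIntegralClosure (k := K) (Ω := AlgebraicClosure K) F (absRestrictNormalHom F τ • y - y) =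
      τ • ringOfIntegersToIntegralClosure (k := K) (Ω := AlgebraicClosure K) F y -
        ringOfIntegersToIntegralClosure (k := K) (Ω := AlgebraicClosure K) F y := by
    rw [map_sub, ringOfIntegersToIntegralClosure_absRestrictNormalHom_smul]
  rw [← h𝔓, Ideal.mem_comap]
  exact e1 ▸ h1

/-- **TOTAL RAMIFICATION OF `v̄` IN `F`, `Γ_K`-currency ⟹ `ord_{w′}(b) = ord_v̄(N_{F/K} b)` at EVERY place `w′ ∣ v̄` of `F`.** Hypothesis:
for every prime `𝔓` of `\\bar ℤ_K` above `v̄` and every `σ ∈ Γ_K` some `τ ∈ I_𝔓` has `τ⁻¹σ ∈ Gal(K̄/F)` (i.e. `Γ_K = I_𝔓 · Gal(K̄/F)`; on the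
line: -w2 g13 `DoublyAdaptedPair.exists_mem_inertia_apply_eq_of_isUnramifiedOutside`, §3). A prime `𝔓` above `w′` exists by going up
(`KummerU.exists_prime_absIntegers_comap_eq`, -w3 g13). [cite: NeukirchANT1999, Ch. I §9 (9.4), (9.6)] -/
theorem log_valuation_eq_log_valuation_norm_of_totallyRamified (vbar : HeightOneSpectrum (𝓞 K))
    (htot : ∀ 𝔓 ∈ vbar.primesAbove, ∀ σ : absoluteGaloisGroup K,
      ∃ τ ∈ 𝔓.inertia (absoluteGaloisGroup K), τ⁻¹ * σ ∈ galFixing K F)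
    (w' : vbar.Extension (𝓞 F)) (b : F) :
    WithZero.log (w'.1.valuation F b) = WithZero.log (vbar.valuation K (Algebra.norm K b)) := by
  obtain ⟨𝔓, h𝔓prime, h𝔓⟩ := KummerU.exists_prime_absIntegers_comap_eq F w'.1
  haveI := h𝔓prime
  have hunder : w'.1.asIdeal.under (𝓞 K) = vbar.asIdeal := congrArg HeightOneSpectrum.asIdeal w'.2
  haveI : w'.1.asIdeal.LiesOver vbar.asIdeal := ⟨hunder.symm⟩
  have h𝔓v : 𝔓 ∈ vbar.primesAbove := by
    refine HeightOneSpectrum.mem_primesAbove_iff.2 ⟨h𝔓prime, ⟨?_⟩⟩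
    rw [Ideal.under_def, KummerU.comap_algebraMap_eq_under_of_comap_eq F h𝔓, hunder]
  exact log_valuation_eq_log_valuation_norm_of_forall_mem_inertia F vbar w'.1
    (forall_mem_inertia_of_absolute F w'.1 𝔓 h𝔓 (htot 𝔓 h𝔓v)) b

end TotallyRamified

/-! ## §2. B5-U ASSEMBLED: -w8 g5's `hB5` binder from total ramification at `v̄` -/

section B5U

variable {K : Type} [Field K] [NumberField K]
  {M : Type} [AddCommGroup M] [TopologicalSpace M] [DiscreteTopology M] [Finite M] (ρ : DiscreteGaloisModule K M)
  {M' : Type} [AddCommGroup M'] [DistribMulAction (absoluteGaloisGroup K) M'] [TopologicalSpace M'] [DiscreteTopology M']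
  (hM' : ∀ m : M', IsOpen {σ : absoluteGaloisGroup K | σ • m = m})
  {n : ℕ} [NeZero n] (B : M →+ M' →+ MuCarrier K n)
  (hB : ∀ (σ : absoluteGaloisGroup K) (m : M) (m' : M'), B (ρ σ m) (ofSMul M' hM' σ m') = mu K n σ (B m m'))
  (F : IntermediateField K (AlgebraicClosure K)) [FiniteDimensional K F] [IsGalois K F] [NumberField F]
  (hU : IsOpen (galFixing K F : Set (absoluteGaloisGroup K)))
  [Fintype (absoluteGaloisGroup K ⧸ galFixing K F)]
  {m₀ : M} (hm₀ : ∀ σ : absoluteGaloisGroup K, ρ σ m₀ = m₀) (hn0 : n • m₀ = 0)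
  (ι' : M' →+ Additive (AlgebraicClosure K)ˣ) (hι'B : ∀ m' : M', Additive.toMul (ι' m') = muVal K n (B m₀ m'))

include hm₀ hn0 hι'B in
/-- **B5-U (the `v̄` reading in `U`-currency) = -w8 g5's displayed `hB5` binder of `LayerShapiro.exists_level_levelSurj_of_classProNull` (B3d),
from TOTAL RAMIFICATION of `v̄` in `F`.** Setting: `ρ` a finite discrete `Γ_K`-module (B3d: `ofSMul N hN`), `M′` with an equivariant pairing
`B : M × M′ → μₙ` and a coefficient embedding `ι′ : M′ ↪ K̄ˣ` REPRESENTED BY `B` at a `Γ_K`-fixed `m₀ ∈ M` (`ι′ = B(m₀, ·)`, `n • m₀ = 0`; for the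
models `ℤ/p^M ↔ μ_{p^M}`: `m₀ = 1`), `F/K` finite Galois with `Γ_K = I_𝔓 · Gal(K̄/F)` for every prime `𝔓 ∣ v̄` of `\\bar ℤ_K`. THEN for all
representatives `s`, every layer cocycle `φ : Gal(K̄/F) → M′` whose dual-Shapiro class satisfies the canonical dual local condition of
`H¹_ur(K_v̄, Maps(Γ_K ⧸ U, M))` at `v̄` (6b clause (iii), VERBATIM), and every Kummer datum `ι′(φ u) = uβ/β`, `βⁿ = b ∈ F`:
`(n : ℤ) ∣ log v_{w′}(b)` at EVERY place `w′ ∣ v̄` of `F` — the `(v̄)` hypothesis of -w3 g13's `KummerU.exists_level_resH1Hom_eq_zero_of_local`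
VERBATIM. (= FILE 1 `dvd_log_valuation_norm_of_dualShapiro_mem` + §1.) [cite: SerreLocalFields1979, XIV §1 Prop. 3, VII §7]
[cite: NeukirchSchmidtWingberg2008, I §5 Prop. (1.5.3)(iv), I §6 (1.6.4)] [cite: NeukirchANT1999, Ch. I §9 (9.6)] -/
theorem dvd_log_valuation_of_dualShapiro_mem_of_totallyRamified (vbar : HeightOneSpectrum (𝓞 K))
    (htot : ∀ 𝔓 ∈ vbar.primesAbove, ∀ σ : absoluteGaloisGroup K,
      ∃ τ ∈ 𝔓.inertia (absoluteGaloisGroup K), τ⁻¹ * σ ∈ galFixing K F)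
    {s : absoluteGaloisGroup K ⧸ galFixing K F → absoluteGaloisGroup K}
    (hs : ∀ y, (s y : absoluteGaloisGroup K ⧸ galFixing K F) = y) (hs1 : s ((1 : absoluteGaloisGroup K) : absoluteGaloisGroup K ⧸ galFixing K F) = 1)
    (φ : contOneCocycles (discreteTopRep (galFixing K F) M'))
    (hvbar : galoisCohomology.localization ((ρ.coind (galFixing K F) hU).tateDual n) (Sum.inr vbar) 1
        (cohomologyMap (coindTateDualMor ρ (ofSMul M' hM') (galFixing K F) B hU hB) 1
          (shapiroLift (ofSMul M' hM').toTopRep (galFixing K F) hU hs hs1 (oneCocycleClass _ φ))) ∈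
      (LocalInvariants.canonical K n).dualLocalCondition (ρ.coind (galFixing K F) hU) (Sum.inr vbar)
        (unramifiedSubgroup (GaloisRep.toLocal vbar (ρ.coind (galFixing K F) hU)) 1))
    (β : (AlgebraicClosure K)ˣ) (hβ : ∀ u : galFixing K F, Additive.toMul (ι' (φ.1 u)) = (u : absoluteGaloisGroup K) • β / β)
    (b : F) (hb : ((b : F) : AlgebraicClosure K) = ((β ^ n : (AlgebraicClosure K)ˣ) : AlgebraicClosure K))
    (w' : vbar.Extension (𝓞 F)) : (n : ℤ) ∣ WithZero.log (w'.1.valuation F b) := by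
  rw [log_valuation_eq_log_valuation_norm_of_totallyRamified F vbar htot w' b]
  exact dvd_log_valuation_norm_of_dualShapiro_mem ρ hM' B hB F hU hs hs1 hm₀ hn0 vbar φ hvbar β
    (fun u ↦ by rw [← hι'B]; exact hβ u) b hb

end B5U

/-! ## §3. On the line: `v̄` is totally ramified in every layer `K*_m` of THE `ℤ_p`-extension unramified outside `v̄` (`p ∤ h_K`) -/

section Line

variable {K : Type} [Field K] [NumberField K] {p : ℕ} [Fact p.Prime]

/-- **`Γ_K = I_𝔓 · Gal(K̄/K*_m)` for every `𝔓 ∣ v̄` and every layer `K*_m`** of the `ℤ_p`-extension `κ` unramified outside `v̄` of an imaginary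
quadratic `K` with `p ∤ h_K`: `κ(I_𝔓) = κ(Γ_K)` (-w2 g13 `DoublyAdaptedPair.exists_mem_inertia_apply_eq_of_isUnramifiedOutside`: every value is
taken on `I_𝔓`), so `σ = τ · (τ⁻¹σ)` with `κ(τ) = κ(σ)`, `τ⁻¹σ ∈ ker κ ≤ κ.layerSubgroup m = Gal(K̄/K*_m)` (`galFixing_layer`).
[cite: deShalit1987, II.1.8, II.4.17] [cite: Washington1997, §13.1 Prop. 13.2] -/
theorem forall_exists_inertia_mul_mem_galFixing_layer (hK : IsImaginaryQuadratic K) (hh : ¬ p ∣ NumberField.classNumber K)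
    {κ : ZpExtension K p} {vbar : HeightOneSpectrum (𝓞 K)} (hκ : κ.IsUnramifiedOutside vbar) (m : ℕ) :
    ∀ 𝔓 ∈ vbar.primesAbove, ∀ σ : absoluteGaloisGroup K,
      ∃ τ ∈ 𝔓.inertia (absoluteGaloisGroup K), τ⁻¹ * σ ∈ galFixing K (κ.layer m) := by
  intro 𝔓 h𝔓 σ
  obtain ⟨τ, hτ, hκτ⟩ := DoublyAdaptedPair.exists_mem_inertia_apply_eq_of_isUnramifiedOutside hK hh hκ h𝔓 (Multiplicative.toAdd (κ σ))
  refine ⟨τ, hτ, ?_⟩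
  rw [Literature.NumberTheory.GaloisCohomology.galFixing_layer K κ m]
  refine κ.kerSubgroup_le_layerSubgroup m (ZpExtension.mem_kerSubgroup.2 ?_)
  rw [map_mul, map_inv, hκτ, ofAdd_toAdd, inv_mul_cancel]

end Line

end Summit.BirchSwinnertonDyer.BirchSwinnertonDyer.Theorems.PrintCf2.NormAtVbar

end
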